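import Mathlib
import HarnessLib
import Summits.MatrixMultiplication.MatrixMultiplication.Theorems.FarEdgeDescentSlabTools
import Summits.MatrixMultiplication.MatrixMultiplication.Theorems.FarEdgeDescentSlabFloor

/-!
# Far-edge descent — β-slab certificates with a β-AFFINE product floor (model level)

`FarEdgeDescentSlabTools` certifies the region criterion on a whole slab `β ∈ [B₀, B₁]` with the CONSTANT
floor `Vmin = floor(B₁)` (the weakest floor of the slab).  Near the symmetric fixed point the margin of the
criterion lives off the product floor, so a constant floor makes wide slabs expensive.  Here the product-floor
constraint carries the AFFINE minorant `c₀ + c₁β` (`c₁ ≤ 0`) of the true floor `Vfloor 2 β z m`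
(`Lfloor_le_Vfloor`: cap the first `n` ratios `τ'ⱼ = min 1 (β/(2−2^{-j}))` by `1`, the others by `β/(2−2^{-j})`),
and the only non-multi-affine term `−c₁β²(u+u'−2uu')` is relaxed by the chord of `β²` on `[B₀,B₁]`
(`gPa5`, `gPa5_eq`, `gPa5_nonneg`).  Everything else is as in the constant-floor tools:

* `cellExprM6`, `cellExprM6_affine`, `cellM6` — the scaled S-procedure form and the endpoint inequality from
  its 32 vertex values;
* `SlabCellClaimA`/`SlabBoxClaimA` (floor `c₀ + c₁β` at `β`), `xsplit6`, `box_of_cell6`, `splitA_u/V/m/W/b`;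
* `regionCriterion_of_slabClaimA` (root ⇒ `RegionCriterion β z ε (c₀+c₁β) κ` for every β of the slab),
  `Lfloor`, `Lfloor_le_Vfloor`, and `capXLD_of_slabClaimA` (root + `c₀+c₁β ≤ Vfloor 2 β z m` on the slab ⇒
  the trees cap XL-D(2, β) for every β of the slab);
* `leafCell6` — the slab leaf cell from certificate data.

No `sorry`.
-/

noncomputable section

set_option linter.dupNamespace false
set_option linter.style.longLine false

namespace Summit.MatrixMultiplication.MatrixMultiplication.Theorems.FarEdgeDescentSlabAffine

open Finset
open Summit.MatrixMultiplication.MatrixMultiplication.Theorems.FarEdgeDescentFloorDial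
open Summit.MatrixMultiplication.MatrixMultiplication.Theorems.FarEdgeDescentFloorDial.Sched
open Summit.MatrixMultiplication.MatrixMultiplication.Theorems.FarEdgeDescentNarrownessPotential
open Summit.MatrixMultiplication.MatrixMultiplication.Theorems.FarEdgeDescentFloorNarrowness
open Summit.MatrixMultiplication.MatrixMultiplication.Theorems.FarEdgeDescentCriterionCells
open Summit.MatrixMultiplication.MatrixMultiplication.Theorems.FarEdgeDescentBoxVertex
open Summit.MatrixMultiplication.MatrixMultiplication.Theorems.FarEdgeDescentCertTools
open Summit.MatrixMultiplication.MatrixMultiplication.Theorems.FarEdgeDescentSlabVertex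
open Summit.MatrixMultiplication.MatrixMultiplication.Theorems.FarEdgeDescentSlabTools

/-! ## The β-affine product-floor constraint -/

/-- `β²·gP` with the affine floor `c₀ + c₁β`, the `β²`-term chord-relaxed on `[B₀, B₁]`
(multi-affine in `u, u', V, V', b`). -/
def gPa5 (z c₀ c₁ B₀ B₁ : ℝ) (u up V W b : ℝ) : ℝ :=
  up * b * (1 - u) * W + u * b * (1 - up) * V + z * u * up * V * W -
      (c₀ * b * (u + up - 2 * u * up) + c₀ * u * up + c₁ * b * u * up) -
    c₁ * (u + up - 2 * u * up) * ((B₀ + B₁) * b - B₀ * B₁)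

/-- `gPa5 = β²·gP(floor c₀+c₁β) + (−c₁)·(u(1−u')+u'(1−u))·(β−B₀)(B₁−β)` at `u = βλ`, `u' = βλ'`. -/
theorem gPa5_eq (z c₀ c₁ B₀ B₁ β lam lam' V W : ℝ) :
    gPa5 z c₀ c₁ B₀ B₁ (β * lam) (β * lam') V W β =
      β ^ 2 * gP β z (c₀ + c₁ * β) lam lam' V W +
        -c₁ * (β * lam * (1 - β * lam') + β * lam' * (1 - β * lam)) * ((β - B₀) * (B₁ - β)) := by
  simp only [gPa5, gP]; ring

/-- The relaxed constraint is non-negative on the region (`c₁ ≤ 0`, `β ∈ [B₀, B₁]`). -/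
theorem gPa5_nonneg {z c₀ c₁ B₀ B₁ β lam lam' V W : ℝ} (hc₁ : c₁ ≤ 0) (e0 : B₀ ≤ β) (e1 : β ≤ B₁)
    (hβ : 0 ≤ β) (b1 : 0 ≤ lam) (b2 : β * lam ≤ 1) (b3 : 0 ≤ lam') (b4 : β * lam' ≤ 1)
    (hG : 0 ≤ gP β z (c₀ + c₁ * β) lam lam' V W) :
    0 ≤ gPa5 z c₀ c₁ B₀ B₁ (β * lam) (β * lam') V W β := by
  rw [gPa5_eq]
  have hS : 0 ≤ β * lam * (1 - β * lam') + β * lam' * (1 - β * lam) := by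
    have h1 := mul_nonneg (mul_nonneg hβ b1) (by linarith : (0:ℝ) ≤ 1 - β * lam')
    have h2 := mul_nonneg (mul_nonneg hβ b3) (by linarith : (0:ℝ) ≤ 1 - β * lam)
    linarith
  have hch : 0 ≤ (β - B₀) * (B₁ - β) := mul_nonneg (by linarith) (by linarith)
  have h3 := mul_nonneg (mul_nonneg (by linarith : (0:ℝ) ≤ -c₁) hS) hch
  have h4 := mul_nonneg (sq_nonneg β) hG
  linarith

/-- The scaled S-procedure form with the affine product floor. -/
def cellExprM6 (z ε c₀ c₁ B₀ B₁ ca cb V₀ V₁ W₀ W₁ μ₁ μ₂ μ₃ μ₄ μ₅ μ₆ μ₇ : ℝ) (u up V W b : ℝ) : ℝ :=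
  cellExpr5 z ε ca cb u up V W b - μ₁ * gPa5 z c₀ c₁ B₀ B₁ u up V W b - μ₂ * gQm5 V₀ V₁ u V b -
    μ₃ * gQp5 V₀ V₁ u V b - μ₄ * gQm5 W₀ W₁ up W b - μ₅ * gQp5 W₀ W₁ up W b - μ₆ * gW5 u V b - μ₇ * gW5 up W b

/-- `cellExprM6` is affine in each of its five variables. -/
theorem cellExprM6_affine (z ε c₀ c₁ B₀ B₁ ca cb V₀ V₁ W₀ W₁ μ₁ μ₂ μ₃ μ₄ μ₅ μ₆ μ₇ : ℝ) :
    (∀ b c d e, ∃ p q : ℝ, ∀ t,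
      cellExprM6 z ε c₀ c₁ B₀ B₁ ca cb V₀ V₁ W₀ W₁ μ₁ μ₂ μ₃ μ₄ μ₅ μ₆ μ₇ t b c d e = p + q * t) ∧
    (∀ a c d e, ∃ p q : ℝ, ∀ t,
      cellExprM6 z ε c₀ c₁ B₀ B₁ ca cb V₀ V₁ W₀ W₁ μ₁ μ₂ μ₃ μ₄ μ₅ μ₆ μ₇ a t c d e = p + q * t) ∧
    (∀ a b d e, ∃ p q : ℝ, ∀ t,
      cellExprM6 z ε c₀ c₁ B₀ B₁ ca cb V₀ V₁ W₀ W₁ μ₁ μ₂ μ₃ μ₄ μ₅ μ₆ μ₇ a b t d e = p + q * t) ∧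
    (∀ a b c e, ∃ p q : ℝ, ∀ t,
      cellExprM6 z ε c₀ c₁ B₀ B₁ ca cb V₀ V₁ W₀ W₁ μ₁ μ₂ μ₃ μ₄ μ₅ μ₆ μ₇ a b c t e = p + q * t) ∧
    (∀ a b c d, ∃ p q : ℝ, ∀ t,
      cellExprM6 z ε c₀ c₁ B₀ B₁ ca cb V₀ V₁ W₀ W₁ μ₁ μ₂ μ₃ μ₄ μ₅ μ₆ μ₇ a b c d t = p + q * t) := by
  refine ⟨fun b c d e => affine_witness fun t => ?_, fun a c d e => affine_witness fun t => ?_,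
    fun a b d e => affine_witness fun t => ?_, fun a b c e => affine_witness fun t => ?_,
    fun a b c d => affine_witness fun t => ?_⟩ <;>
  simp only [cellExprM6, cellExpr5, gPa5, gQm5, gQp5, gW5] <;> ring

/-- **Endpoint inequality on a slab box from the 32 vertices (affine floor).** -/
theorem cellM6 {z ε c₀ c₁ B₀ B₁ ca cb u₀ u₁ V₀ V₁ m₀ m₁ W₀ W₁ μ₁ μ₂ μ₃ μ₄ μ₅ μ₆ μ₇ : ℝ} (hc₁ : c₁ ≤ 0)
    (hμ₁ : 0 ≤ μ₁) (hμ₂ : 0 ≤ μ₂) (hμ₃ : 0 ≤ μ₃) (hμ₄ : 0 ≤ μ₄) (hμ₅ : 0 ≤ μ₅) (hμ₆ : 0 ≤ μ₆) (hμ₇ : 0 ≤ μ₇)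
    (hv : ∀ a b c d e : ℝ, (a = u₀ ∨ a = u₁) → (b = m₀ ∨ b = m₁) → (c = V₀ ∨ c = V₁) → (d = W₀ ∨ d = W₁) →
      (e = B₀ ∨ e = B₁) → 0 ≤ cellExprM6 z ε c₀ c₁ B₀ B₁ ca cb V₀ V₁ W₀ W₁ μ₁ μ₂ μ₃ μ₄ μ₅ μ₆ μ₇ a b c d e)
    {β lam lam' V V' VP : ℝ} (hβ : 0 < β) (e0 : B₀ ≤ β) (e1 : β ≤ B₁)
    (a1 : u₀ ≤ β * lam) (a2 : β * lam ≤ u₁) (a3 : V₀ ≤ V) (a4 : V ≤ V₁) (a5 : m₀ ≤ β * lam')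
    (a6 : β * lam' ≤ m₁) (a7 : W₀ ≤ V') (a8 : V' ≤ W₁) (b1 : 0 ≤ lam) (b2 : β * lam ≤ 1) (b3 : 0 ≤ lam')
    (b4 : β * lam' ≤ 1) (c1 : β * ((2 * β - 1) * lam - 1) ≤ (β - 1) * V)
    (c2 : β * ((2 * β - 1) * lam' - 1) ≤ (β - 1) * V') (c3 : |1 - (2 * β - 1) * lam| ≤ V ^ 2)
    (c4 : |1 - (2 * β - 1) * lam'| ≤ V' ^ 2)
    (hP : VP * (lam + lam' - (2 * β - 1) * lam * lam') =
      lam' * (1 - β * lam) * V' + lam * (1 - β * lam') * V + z * lam * lam' * V * V')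
    (hVP : c₀ + c₁ * β ≤ VP) :
    (1 - (β - 1) * lam') * (lam * (ε + 1 - V)) * ca + (1 - (β - 1) * lam) * (lam' * (ε + 1 - V')) * cb ≤
      (lam + lam' - (2 * β - 1) * lam * lam') * (ε + 1 - VP) := by
  obtain ⟨h1, h2, h3, h4, h5⟩ :=
    cellExprM6_affine z ε c₀ c₁ B₀ B₁ ca cb V₀ V₁ W₀ W₁ μ₁ μ₂ μ₃ μ₄ μ₅ μ₆ μ₇
  have key := box5 h1 h2 h3 h4 h5 hv (β * lam) (β * lam') V V' β a1 a2 a5 a6 a3 a4 a7 a8 e0 e1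
  obtain ⟨g1, g2, g3, g4, g5, g6, g7⟩ :=
    constraints_nonneg (z := z) (Vmin := c₀ + c₁ * β) (V₀ := V₀) (V₁ := V₁) (W₀ := W₀) (W₁ := W₁)
      b1 b2 b3 b4 a3 a4 a7 a8 c1 c2 c3 c4 hP hVP
  have g1' := gPa5_nonneg (z := z) (V := V) (W := V') hc₁ e0 e1 hβ.le b1 b2 b3 b4 g1
  obtain ⟨s1, -, s3, s4, s5⟩ := scale_ids β z ε (c₀ + c₁ * β) ca cb V₀ V₁ lam lam' V V'
  obtain ⟨-, -, s3', s4', s5'⟩ := scale_ids β z ε (c₀ + c₁ * β) ca cb W₀ W₁ lam' lam V' V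
  have eM : cellExprM6 z ε c₀ c₁ B₀ B₁ ca cb V₀ V₁ W₀ W₁ μ₁ μ₂ μ₃ μ₄ μ₅ μ₆ μ₇ (β * lam) (β * lam') V V' β =
      β ^ 2 * cellExpr β z ε ca cb lam lam' V V' -
        (μ₁ * gPa5 z c₀ c₁ B₀ B₁ (β * lam) (β * lam') V V' β + μ₂ * (β * gQm β V₀ V₁ lam V) +
          μ₃ * (β * gQp β V₀ V₁ lam V) + μ₄ * (β * gQm β W₀ W₁ lam' V') + μ₅ * (β * gQp β W₀ W₁ lam' V') +
          μ₆ * gW β lam V + μ₇ * gW β lam' V') := by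
    simp only [cellExprM6]; rw [s1, s3, s4, s5, s3', s4', s5']; ring
  have eC : cellExpr β z ε ca cb lam lam' V V' =
      (lam + lam' - (2 * β - 1) * lam * lam') * (ε + 1 - VP) -
        ((1 - (β - 1) * lam') * (lam * (ε + 1 - V)) * ca +
          (1 - (β - 1) * lam) * (lam' * (ε + 1 - V')) * cb) := by
    simp only [cellExpr]; linear_combination hP
  have hb2 : 0 < β ^ 2 := by positivity
  have m1 := mul_nonneg hμ₁ g1'
  have m2 := mul_nonneg hμ₂ (mul_nonneg hβ.le g2)
  have m3 := mul_nonneg hμ₃ (mul_nonneg hβ.le g3)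
  have m4 := mul_nonneg hμ₄ (mul_nonneg hβ.le g4)
  have m5 := mul_nonneg hμ₅ (mul_nonneg hβ.le g5)
  have m6 := mul_nonneg hμ₆ g6
  have m7 := mul_nonneg hμ₇ g7
  have hX : 0 ≤ β ^ 2 * cellExpr β z ε ca cb lam lam' V V' := by linarith [key, eM]
  have hX' : 0 ≤ cellExpr β z ε ca cb lam lam' V V' := (mul_nonneg_iff_of_pos_left hb2).mp hX
  linarith [hX', eC]

/-! ## Claims with the affine floor, and their combinators -/

/-- The slab cell claim with floor `c₀ + c₁β` at `β`, for every `β ∈ [B₀, B₁]`. -/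
def SlabCellClaimA (B₀ B₁ z ε c₀ c₁ κ u₀ u₁ V₀ V₁ m₀ m₁ W₀ W₁ x₁ x₂ : ℝ) : Prop :=
  ∀ β : ℝ, B₀ ≤ β → β ≤ B₁ → SlabCellClaim β β z ε (c₀ + c₁ * β) κ u₀ u₁ V₀ V₁ m₀ m₁ W₀ W₁ x₁ x₂

/-- The slab box claim with the affine floor (the cell claim on `[0, 1]`). -/
def SlabBoxClaimA (B₀ B₁ z ε c₀ c₁ κ u₀ u₁ V₀ V₁ m₀ m₁ W₀ W₁ : ℝ) : Prop :=
  SlabCellClaimA B₀ B₁ z ε c₀ c₁ κ u₀ u₁ V₀ V₁ m₀ m₁ W₀ W₁ 0 1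

/-- Glue two x-cells. -/
theorem xsplit6 {B₀ B₁ z ε c₀ c₁ κ u₀ u₁ V₀ V₁ m₀ m₁ W₀ W₁ x₁ xm x₂ : ℝ}
    (h1 : SlabCellClaimA B₀ B₁ z ε c₀ c₁ κ u₀ u₁ V₀ V₁ m₀ m₁ W₀ W₁ x₁ xm)
    (h2 : SlabCellClaimA B₀ B₁ z ε c₀ c₁ κ u₀ u₁ V₀ V₁ m₀ m₁ W₀ W₁ xm x₂) :
    SlabCellClaimA B₀ B₁ z ε c₀ c₁ κ u₀ u₁ V₀ V₁ m₀ m₁ W₀ W₁ x₁ x₂ :=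
  fun β e0 e1 => xsplit5 (h1 β e0 e1) (h2 β e0 e1)

/-- A box claim is the cell claim on `[0, 1]`. -/
theorem box_of_cell6 {B₀ B₁ z ε c₀ c₁ κ u₀ u₁ V₀ V₁ m₀ m₁ W₀ W₁ : ℝ}
    (h : SlabCellClaimA B₀ B₁ z ε c₀ c₁ κ u₀ u₁ V₀ V₁ m₀ m₁ W₀ W₁ 0 1) :
    SlabBoxClaimA B₀ B₁ z ε c₀ c₁ κ u₀ u₁ V₀ V₁ m₀ m₁ W₀ W₁ := h

/-- Bisection in `u = βλ`. -/
theorem splitA_u {B₀ B₁ z ε c₀ c₁ κ u₀ um u₁ V₀ V₁ m₀ m₁ W₀ W₁ : ℝ}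
    (h1 : SlabBoxClaimA B₀ B₁ z ε c₀ c₁ κ u₀ um V₀ V₁ m₀ m₁ W₀ W₁)
    (h2 : SlabBoxClaimA B₀ B₁ z ε c₀ c₁ κ um u₁ V₀ V₁ m₀ m₁ W₀ W₁) :
    SlabBoxClaimA B₀ B₁ z ε c₀ c₁ κ u₀ u₁ V₀ V₁ m₀ m₁ W₀ W₁ :=
  fun β e0 e1 => split_u (h1 β e0 e1) (h2 β e0 e1)

/-- Bisection in `V`. -/
theorem splitA_V {B₀ B₁ z ε c₀ c₁ κ u₀ u₁ V₀ Vm V₁ m₀ m₁ W₀ W₁ : ℝ}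
    (h1 : SlabBoxClaimA B₀ B₁ z ε c₀ c₁ κ u₀ u₁ V₀ Vm m₀ m₁ W₀ W₁)
    (h2 : SlabBoxClaimA B₀ B₁ z ε c₀ c₁ κ u₀ u₁ Vm V₁ m₀ m₁ W₀ W₁) :
    SlabBoxClaimA B₀ B₁ z ε c₀ c₁ κ u₀ u₁ V₀ V₁ m₀ m₁ W₀ W₁ :=
  fun β e0 e1 => split_V5 (h1 β e0 e1) (h2 β e0 e1)

/-- Bisection in `u' = βλ'`. -/
theorem splitA_m {B₀ B₁ z ε c₀ c₁ κ u₀ u₁ V₀ V₁ m₀ mm m₁ W₀ W₁ : ℝ}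
    (h1 : SlabBoxClaimA B₀ B₁ z ε c₀ c₁ κ u₀ u₁ V₀ V₁ m₀ mm W₀ W₁)
    (h2 : SlabBoxClaimA B₀ B₁ z ε c₀ c₁ κ u₀ u₁ V₀ V₁ mm m₁ W₀ W₁) :
    SlabBoxClaimA B₀ B₁ z ε c₀ c₁ κ u₀ u₁ V₀ V₁ m₀ m₁ W₀ W₁ :=
  fun β e0 e1 => split_m5 (h1 β e0 e1) (h2 β e0 e1)

/-- Bisection in `V'`. -/
theorem splitA_W {B₀ B₁ z ε c₀ c₁ κ u₀ u₁ V₀ V₁ m₀ m₁ W₀ Wm W₁ : ℝ}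
    (h1 : SlabBoxClaimA B₀ B₁ z ε c₀ c₁ κ u₀ u₁ V₀ V₁ m₀ m₁ W₀ Wm)
    (h2 : SlabBoxClaimA B₀ B₁ z ε c₀ c₁ κ u₀ u₁ V₀ V₁ m₀ m₁ Wm W₁) :
    SlabBoxClaimA B₀ B₁ z ε c₀ c₁ κ u₀ u₁ V₀ V₁ m₀ m₁ W₀ W₁ :=
  fun β e0 e1 => split_W5 (h1 β e0 e1) (h2 β e0 e1)

/-- Bisection in `β` (the floor coefficients and the chord interval `[B₀,B₁]` of `gPa5` live in the LEAF data,
so the two halves are claims of the same shape; only the range of `β` is split). -/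
theorem splitA_b {B₀ Bm B₁ z ε c₀ c₁ κ u₀ u₁ V₀ V₁ m₀ m₁ W₀ W₁ : ℝ}
    (h1 : SlabBoxClaimA B₀ Bm z ε c₀ c₁ κ u₀ u₁ V₀ V₁ m₀ m₁ W₀ W₁)
    (h2 : SlabBoxClaimA Bm B₁ z ε c₀ c₁ κ u₀ u₁ V₀ V₁ m₀ m₁ W₀ W₁) :
    SlabBoxClaimA B₀ B₁ z ε c₀ c₁ κ u₀ u₁ V₀ V₁ m₀ m₁ W₀ W₁ := by
  intro β e0 e1
  rcases le_total β Bm with h | h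
  · exact h1 β e0 h
  · exact h2 β h e1

/-- Shrinking the box from below in `V` and `V'` keeps a (constant-floor) slab claim. -/
theorem mono_floor5 {B₀ B₁ z ε Vmin κ u₀ u₁ V₀ V₀' V₁ m₀ m₁ W₀ W₀' W₁ x₁ x₂ : ℝ} (hV : V₀ ≤ V₀')
    (hW : W₀ ≤ W₀') (h : SlabCellClaim B₀ B₁ z ε Vmin κ u₀ u₁ V₀ V₁ m₀ m₁ W₀ W₁ x₁ x₂) :
    SlabCellClaim B₀ B₁ z ε Vmin κ u₀ u₁ V₀' V₁ m₀ m₁ W₀' W₁ x₁ x₂ := by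
  intro β lam lam' V V' VP x e0 e1 a1 a2 a3 a4 a5 a6 a7 a8 b1 b2 b3 b4 b5 b6 b7 b8 c1 c2 c3 c4 hP hVP
    hx1 hx2 hx0 hx1'
  exact h β lam lam' V V' VP x e0 e1 a1 a2 (hV.trans a3) a4 a5 a6 (hW.trans a7) a8 b1 b2 b3 b4 b5 b6 b7
    b8 c1 c2 c3 c4 hP hVP hx1 hx2 hx0 hx1'

/-- **Root.**  The affine-floor slab claim on `[0,1] × [Vb,1] × [0,1] × [Vb,1]`, `0 ≤ Vb ≤ c₀ + c₁B₁`,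
`c₁ ≤ 0`, gives `RegionCriterion β z ε (c₀ + c₁β) κ` for every `β ∈ [B₀, B₁]` (`0 < B₀`). -/
theorem regionCriterion_of_slabClaimA {B₀ B₁ z ε c₀ c₁ κ Vb : ℝ} (hB : 0 < B₀) (hc₁ : c₁ ≤ 0)
    (hVb0 : 0 ≤ Vb) (hVb : Vb ≤ c₀ + c₁ * B₁)
    (h : SlabBoxClaimA B₀ B₁ z ε c₀ c₁ κ 0 1 Vb 1 0 1 Vb 1) :
    ∀ β : ℝ, B₀ ≤ β → β ≤ B₁ → RegionCriterion β z ε (c₀ + c₁ * β) κ := by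
  intro β e0 e1
  have hβ : 0 < β := lt_of_lt_of_le hB e0
  have hL : Vb ≤ c₀ + c₁ * β := by nlinarith
  have h' : SlabBoxClaim β β z ε (c₀ + c₁ * β) κ 0 1 (c₀ + c₁ * β) 1 0 1 (c₀ + c₁ * β) 1 :=
    mono_floor5 hL hL (h β e0 e1)
  exact regionCriterion_of_slabClaim hβ (hVb0.trans hL) h' β le_rfl le_rfl

/-! ## The affine minorant of the floor -/

/-- Affine minorant of `Vfloor 2 β z m`: cap the first `n` ratios by `1`, the others by `β/(2 − 2^{-j})`. -/
def Lfloor (z : ℝ) (m n : ℕ) (β : ℝ) : ℝ :=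
  1 - (1 - z) * ∑ k ∈ range m, (if k < n then (1:ℝ) else β / (2 - (2:ℝ)⁻¹ ^ (k + 2))) * z ^ k -
    β / (2 - (2:ℝ)⁻¹ ^ (m + 2)) * z ^ m

/-- `Lfloor z m n β ≤ Vfloor 2 β z m` for every `β` (`0 ≤ z ≤ 1`). -/
theorem Lfloor_le_Vfloor {z : ℝ} (hz0 : 0 ≤ z) (hz1 : z ≤ 1) (m n : ℕ) (β : ℝ) :
    Lfloor z m n β ≤ Vfloor 2 β z m := by
  unfold Lfloor Vfloor
  have hterm : ∀ k ∈ range m, tauP 2 β (k + 2) * z ^ k ≤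
      (if k < n then (1:ℝ) else β / (2 - (2:ℝ)⁻¹ ^ (k + 2))) * z ^ k := by
    intro k _
    apply mul_le_mul_of_nonneg_right _ (pow_nonneg hz0 k)
    unfold tauP
    split_ifs
    · exact min_le_left _ _
    · exact min_le_right _ _
  have hsum := Finset.sum_le_sum hterm
  have hlast : tauP 2 β (m + 2) * z ^ m ≤ β / (2 - (2:ℝ)⁻¹ ^ (m + 2)) * z ^ m :=
    mul_le_mul_of_nonneg_right (min_le_right _ _) (pow_nonneg hz0 m)
  have h1z : (0:ℝ) ≤ 1 - z := by linarith
  have hs := mul_le_mul_of_nonneg_left hsum h1z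
  linarith

/-- **Root + floor ⇒ the trees cap XL-D(2, β) for every β of the slab.** -/
theorem capXLD_of_slabClaimA {B₀ B₁ z ε c₀ c₁ Vb : ℝ} (m : ℕ) (hB : 3 / 2 ≤ B₀) (hB1 : B₁ ≤ 2)
    (hz : 9 / 10 ≤ z) (hz1 : z ≤ 1) (hε : 0 < ε) (hc₁ : c₁ ≤ 0) (hVb0 : 0 ≤ Vb) (hVb : Vb ≤ c₀ + c₁ * B₁)
    (hfl : ∀ β : ℝ, B₀ ≤ β → β ≤ B₁ → c₀ + c₁ * β ≤ Vfloor 2 β z m)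
    (h : SlabBoxClaimA B₀ B₁ z ε c₀ c₁ (Real.log (4 / 3) / Real.log 2) 0 1 Vb 1 0 1 Vb 1) :
    ∀ β : ℝ, B₀ ≤ β → β ≤ B₁ →
      ∀ R : ℝ, 0 ≤ R → ∀ y₀ : ℝ → ℝ, (∀ b : ℝ, 0 ≤ b → 0 ≤ y₀ b ∧ y₀ b ≤ R / (b + β)) →
        ∃ C : ℝ, ∀ s : Sched, Admissible 2 β s →
          dev β y₀ s ≤ C * logSize β s ^ (Real.log (4 / 3) / Real.log 2) :=
  fun β e0 e1 => capXLD_of_regionCriterion_le m le_rfl (hB.trans e0) (e1.trans hB1) hz hz1 hε (hfl β e0 e1)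
    (regionCriterion_of_slabClaimA (by linarith) hc₁ hVb0 hVb h β e0 e1)

/-! ## Leaf cell from data -/

/-- **Affine-floor slab leaf cell from data** (as `FarEdgeDescentSlabTools.leafCell5`, the product-floor
constraint being `gPa5`; `0 < B₀`, `c₁ ≤ 0`). -/
theorem leafCell6 {B₀ B₁ z ε c₀ c₁ κ u₀ u₁ V₀ V₁ m₀ m₁ W₀ W₁ x₁ x₂ ρ σ ca₁ cb₁ ca₂ cb₂ : ℝ}
    {μ₁ μ₂ μ₃ μ₄ μ₅ μ₆ μ₇ ν₁ ν₂ ν₃ ν₄ ν₅ ν₆ ν₇ : ℝ}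
    (hB : 0 < B₀) (hc₁ : c₁ ≤ 0) (hε : 0 ≤ ε) (hκ : 17 / 41 ≤ κ) (hκ1 : κ ≤ 1)
    (hx₁ : 0 ≤ x₁) (hx12 : x₁ < x₂) (hx₂ : x₂ ≤ 1) (hρ : x₂ ^ κ ≤ ρ) (hσ : (1 - x₁) ^ κ ≤ σ)
    (hca₁ : ρ * (1 + 17 / 41 * (x₁ / x₂ - 1)) ≤ ca₁) (hcb₁ : σ ≤ cb₁) (hca₂ : ρ ≤ ca₂)
    (hcb₂ : σ * (1 + 17 / 41 * ((1 - x₂) / (1 - x₁) - 1)) ≤ cb₂)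
    (hμ : 0 ≤ μ₁ ∧ 0 ≤ μ₂ ∧ 0 ≤ μ₃ ∧ 0 ≤ μ₄ ∧ 0 ≤ μ₅ ∧ 0 ≤ μ₆ ∧ 0 ≤ μ₇)
    (hν : 0 ≤ ν₁ ∧ 0 ≤ ν₂ ∧ 0 ≤ ν₃ ∧ 0 ≤ ν₄ ∧ 0 ≤ ν₅ ∧ 0 ≤ ν₆ ∧ 0 ≤ ν₇)
    (hv₁ : ∀ a b c d e : ℝ, (a = u₀ ∨ a = u₁) → (b = m₀ ∨ b = m₁) → (c = V₀ ∨ c = V₁) → (d = W₀ ∨ d = W₁) →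
      (e = B₀ ∨ e = B₁) →
        0 ≤ cellExprM6 z ε c₀ c₁ B₀ B₁ ca₁ cb₁ V₀ V₁ W₀ W₁ μ₁ μ₂ μ₃ μ₄ μ₅ μ₆ μ₇ a b c d e)
    (hv₂ : ∀ a b c d e : ℝ, (a = u₀ ∨ a = u₁) → (b = m₀ ∨ b = m₁) → (c = V₀ ∨ c = V₁) → (d = W₀ ∨ d = W₁) →
      (e = B₀ ∨ e = B₁) →
        0 ≤ cellExprM6 z ε c₀ c₁ B₀ B₁ ca₂ cb₂ V₀ V₁ W₀ W₁ ν₁ ν₂ ν₃ ν₄ ν₅ ν₆ ν₇ a b c d e) :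
    SlabCellClaimA B₀ B₁ z ε c₀ c₁ κ u₀ u₁ V₀ V₁ m₀ m₁ W₀ W₁ x₁ x₂ := by
  intro β e0 e1 β' lam lam' V V' VP x f0 f1 a1 a2 a3 a4 a5 a6 a7 a8 b1 b2 b3 b4 b5 b6 b7 b8 c1 c2 c3 c4
    hP hVP hx1 hx2 hx0 hx1'
  obtain rfl : β' = β := le_antisymm f1 f0
  have hβ : 0 < β' := lt_of_lt_of_le hB e0
  obtain ⟨hμ₁, hμ₂, hμ₃, hμ₄, hμ₅, hμ₆, hμ₇⟩ := hμ
  obtain ⟨hν₁, hν₂, hν₃, hν₄, hν₅, hν₆, hν₇⟩ := hν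
  have E1 := cellM6 hc₁ hμ₁ hμ₂ hμ₃ hμ₄ hμ₅ hμ₆ hμ₇ hv₁ hβ e0 e1 a1 a2 a3 a4 a5 a6 a7 a8 b1 b2 b3 b4 c1
    c2 c3 c4 hP hVP
  have E2 := cellM6 hc₁ hν₁ hν₂ hν₃ hν₄ hν₅ hν₆ hν₇ hv₂ hβ e0 e1 a1 a2 a3 a4 a5 a6 a7 a8 b1 b2 b3 b4 c1
    c2 c3 c4 hP hVP
  set A := (1 - (β' - 1) * lam') * (lam * (ε + 1 - V)) with hA_def
  set B := (1 - (β' - 1) * lam) * (lam' * (ε + 1 - V')) with hB_def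
  set R := (lam + lam' - (2 * β' - 1) * lam * lam') * (ε + 1 - VP) with hR_def
  have hA : 0 ≤ A := by
    have : (β' - 1) * lam' ≤ β' * lam' := mul_le_mul_of_nonneg_right (by linarith) b3
    exact mul_nonneg (by linarith) (mul_nonneg b1 (by linarith))
  have hB : 0 ≤ B := by
    have : (β' - 1) * lam ≤ β' * lam := mul_le_mul_of_nonneg_right (by linarith) b1
    exact mul_nonneg (by linarith) (mul_nonneg b3 (by linarith))
  have hx2pos : 0 < x₂ := lt_of_le_of_lt hx₁ hx12
  have h1x1 : 0 < 1 - x₁ := by linarith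
  have hκ0 : (0:ℝ) ≤ 17 / 41 := by norm_num
  have T1 : x ^ κ ≤ ρ * (1 + 17 / 41 * (x / x₂ - 1)) := tangent_right hx0 hx2 hx2pos hκ hκ0 hκ1 hρ
  have T2 : (1 - x) ^ κ ≤ σ * (1 + 17 / 41 * ((1 - x) / (1 - x₁) - 1)) :=
    tangent_right (by linarith) (by linarith) h1x1 hκ hκ0 hκ1 hσ
  have M : A * x ^ κ + B * (1 - x) ^ κ ≤
      A * (ρ * (1 + 17 / 41 * (x / x₂ - 1))) + B * (σ * (1 + 17 / 41 * ((1 - x) / (1 - x₁) - 1))) := by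
    have := mul_le_mul_of_nonneg_left T1 hA
    have := mul_le_mul_of_nonneg_left T2 hB
    linarith
  have P1 : A * (ρ * (1 + 17 / 41 * (x₁ / x₂ - 1))) + B * (σ * (1 + 17 / 41 * ((1 - x₁) / (1 - x₁) - 1))) ≤ R := by
    have e : (1 - x₁) / (1 - x₁) = 1 := div_self h1x1.ne'
    rw [e]
    have u1 := mul_le_mul_of_nonneg_left hca₁ hA
    have u2 : B * (σ * (1 + 17 / 41 * (1 - 1))) ≤ B * cb₁ := by
      have : σ * (1 + 17 / 41 * (1 - 1)) = σ := by ring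
      rw [this]; exact mul_le_mul_of_nonneg_left hcb₁ hB
    linarith [E1]
  have P2 : A * (ρ * (1 + 17 / 41 * (x₂ / x₂ - 1))) + B * (σ * (1 + 17 / 41 * ((1 - x₂) / (1 - x₁) - 1))) ≤ R := by
    have e : x₂ / x₂ = 1 := div_self hx2pos.ne'
    rw [e]
    have u1 : A * (ρ * (1 + 17 / 41 * (1 - 1))) ≤ A * ca₂ := by
      have : ρ * (1 + 17 / 41 * (1 - 1)) = ρ := by ring
      rw [this]; exact mul_le_mul_of_nonneg_left hca₂ hA
    have u2 := mul_le_mul_of_nonneg_left hcb₂ hB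
    linarith [E2]
  have e : ∀ t : ℝ, A * (ρ * (1 + 17 / 41 * (t / x₂ - 1))) + B * (σ * (1 + 17 / 41 * ((1 - t) / (1 - x₁) - 1))) =
      (A * ρ * (1 - 17 / 41) + B * σ * (1 + 17 / 41 * (1 / (1 - x₁) - 1))) +
        (A * ρ * (17 / 41) / x₂ - B * σ * (17 / 41) / (1 - x₁)) * t := by
    intro t; field_simp; ring
  rw [e] at M P1 P2
  exact M.trans (FarEdgeDescentCriterionCells.lin_cell P1 P2 hx1 hx2)

end Summit.MatrixMultiplication.MatrixMultiplication.Theorems.FarEdgeDescentSlabAffine
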